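import Summits.BirchSwinnertonDyer.BirchSwinnertonDyer.Theorems.AlignedTransportAtTwoMainConjectureOfRankZeroBSDAtTwoCubicProCyclicDoor
import Summits.BirchSwinnertonDyer.BirchSwinnertonDyer.Theorems.AlignedTransportAtTwoMainConjectureOfRankZeroBSDAtTwoCubicDoorsDeadSubcellClassNumberD
import Literature.NumberTheory.NumberFields.CubicFieldIntegers
import Literature.NumberTheory.NumberFields.CubicFieldResiduePrimes
import HarnessLib

/-!
# Route `AlignedTransportAtTwo`, crux C2 `MainConjectureOfRankZeroBSDAtTwo` (stmt-BirchSwinnertonDyer-22298):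
# THE PRO-CYCLIC DOOR'S SECOND CUSTOMER `N = 4827` — for the cubic field of discriminant `−4827` (`2`-torsion field of the RANK-ONE curve `[1,1,0,−24,−57]`):
# `4 ∣ h(ℚ(β,√2))` ⟹ `rank₂ Cl(K_m) ≤ 1` in every layer, `μ₂ = 0`, `λ₂ ≤ 1` (a FIELD theorem; no `MC₂` row — the curve has analytic rank one)

HONEST FRAMING (cell `bsd-f1-sign2`, WIDTH-5 attached prover seat `bsd-line-att-p3` gen 46 on line `birth` of the lead `bsd-line-att-p2`;
`--supports` stmt-BirchSwinnertonDyer-22298, closes nothing; BSD is NOT proved by any of this; the crux C2, its verdict «blocked-on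
`Rank1Residual.GreenbergMuConjectureIrreducible`» and every registered stub are untouched).  THEOREMS ONLY — no definition, no named fact, no `sorry`.
Sequel of this seat's `…CubicProCyclicDoor` (the W-level pro-cyclic door) on att-p4 g38's model of the cubic field of discriminant `−4827`
(`…CubicDoorsDeadSubcellClassNumberD`: `θ ∈ ℚ(β)` a root of `f = X³ − 2X² + 10X + 3`, `𝓞 = ℤ[θ]`, `h = 1`, good ordinary at `2`, `Δ_min = −4827 ≡ 5 (8)`).

THE KERNEL-DECIDED DATA of the door for this field (this seat's census: `t = 3` (`σ₁(ε) ≡ 23 (mod 64)`), `e₁ = 2` (the classes of the bit-`−1` primes `𝔔₇, 𝔔₂₃, 𝔔₄₁` of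
`ℚ(β,√2)` have order exactly `4`: `𝔔⁴` principal with an explicit generator, `𝔔²` not found principal — census-grade); the field was typed by att-p4 g38 (file D)):
* `𝔭₁ = (2, θ + 1) = (π₁)`, `π₁ = −1 − 3θ + 2θ²`, `N(𝔭₁) = 2` (the kernel of the residue map `θ ↦ 1 (mod 2)`; att-p4's `CubicDisc4827.span_2_lin1_eq`);
* the unit `ε = −348583873 + 74735402θ − 32751818θ²` (inverse `1631 + 5770θ − 58θ²`, one `linear_combination`);
* **`ε − 1 ∉ 𝔭₁⁴` and `ε + 1 ∉ 𝔭₁⁴`** (`2`-adic depth `t ≤ 3`): the residue map `ρ : 𝓞 → ℤ/16`, `θ ↦ 5` (`f(5) = 128 ≡ 0`), kills `π₁⁴` (`ρ(π₁) = 2`) but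
  `ρ(ε ∓ 1) = 6, 8 ≠ 0`.
So the door's only remaining input is the class-number bit **`2 ≤ ord₂ h(K_1)`** (`4 ∣ h(ℚ(β,√2))` — a LOWER bound on a class group of the sextic layer, not kernelised), displayed as `he1`.

* ★★ `classGroupPRank_le_one_cubicField_n4827` — `β` any root of the `2`-division cubic of `[1,1,0,−24,−57]`, `κ` a cyclotomic `ℤ₂`-extension of `ℚ(β)` with
  `2 ≤ ord₂ h(K_1)` ⟹ `rank₂ Cl(K_m) ≤ 1 ∀ m`, `μ₂(κ) = 0`, `λ₂(κ) ≤ 1`.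
* no `MC₂` row: `[1,1,0,−24,−57]` has analytic rank ONE (att-p4 g38), so the C2 carrier road (`r_an = 0`) does not apply; the field theorem is what the cell's
  `μ₂`-census (and any rank-one carrier over `ℚ(β)`) consumes.

Nothing is closed; BSD is not proved; no Cremona label is asserted (names use the conductor `4827`).

References: [Washington1997] §13.3 Prop. 13.22–13.23; [Lang1990] Ch. 13 §4 Lemma 4.1; [Fukuda1994] Thm. 1 (2); [NeukirchANT1999] Ch. V §1; [Marcus2018] Ch. 3 Thm. 27;
[LMFDB] number field 3.1.4827.1.
-/

set_option linter.dupNamespace false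
set_option autoImplicit false

noncomputable section

open scoped Classical NumberField nonZeroDivisors IntermediateField

namespace Summit.BirchSwinnertonDyer.BirchSwinnertonDyer.Theorems.AlignedTransportAtTwoCubicProCyclicRowN4827

open NumberField IsDedekindDomain Polynomial WeierstrassCurve IntermediateField CongruenceSubgroup Module
  Literature.NumberTheory.IwasawaTheory Literature.NumberTheory.GaloisRepresentations
  Literature.NumberTheory.GaloisRepresentations.Herbrand Literature.NumberTheory.GaloisRepresentations.MinkowskiUnit
  Literature.NumberTheory.GaloisRepresentations.CyclicNormIndex
  Literature.NumberTheory.EllipticCurves Literature.NumberTheory.EllipticCurves.Greenberg1999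
  Literature.NumberTheory.EllipticCurves.ModularForms Literature.NumberTheory.EllipticCurves.Rank1Residual
  Literature.NumberTheory.EllipticCurves.Module
  Literature.NumberTheory.NumberFields Literature.NumberTheory.CubicFields
  Summit.BirchSwinnertonDyer.Rank1Residual Summit.BirchSwinnertonDyer.Rank1Residual.X1.MuLambda
  Summit.BirchSwinnertonDyer.Rank1Residual.X5 Summit.BirchSwinnertonDyer.Rank1Residual.X5.O1
  Summit.BirchSwinnertonDyer.Rank1Residual.X5.Instances Summit.BirchSwinnertonDyer.Rank1Residual.F1Sign2
  Summit.BirchSwinnertonDyer.BirchSwinnertonDyer.Theorems.Rank1ResidualX1Defs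
  Summit.BirchSwinnertonDyer.BirchSwinnertonDyer.Theses.AlignedTransportAtTwo
  Summit.BirchSwinnertonDyer.BirchSwinnertonDyer.Theorems.AlignedTransportAtTwoKilfordStratumShared
  Summit.BirchSwinnertonDyer.BirchSwinnertonDyer.Theorems.AlignedTransportAtTwoCubicCarrierRoad
  Summit.BirchSwinnertonDyer.BirchSwinnertonDyer.Theorems.AlignedTransportAtTwoCubicProCyclicDoor
  Summit.BirchSwinnertonDyer.BirchSwinnertonDyer.Theorems.AlignedTransportAtTwoCubicDoorsDeadSubcellClassNumberD

/-! ## §1 Residue maps of `𝓞_{ℚ(β)} = ℤ[θ]` and the dyadic prime `𝔭₁ = (π₁)` -/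

/-- A ring homomorphism `ψ₂ : 𝓞_{ℚ(β)} → ℤ/2` with `ψ₂(θ) = 1` (the degree-one dyadic prime `𝔭₁ = (2, θ + 1)`; `f ≡ (X + 1)(X² + X + 1) (mod 2)`).
[cite: Marcus2018, Ch. 3, Thm. 27] -/
theorem exists_residueHom_two_n4827 {β : AlgebraicClosure ℚ} (hβ : aeval β ((⟨1, 1, 0, -24, -57⟩ : WeierstrassCurve ℤ).baseChange ℚ).twoTorsionPolynomial.toPoly = 0) :
    ∃ ψ : 𝓞 ↥(IntermediateField.adjoin ℚ ({β} : Set (AlgebraicClosure ℚ))) →+* ZMod 2, ψ (MonicCubic.thetaInt (aeval_theta_n4827 hβ)) = (((-1) : ℤ) : ZMod 2) :=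
  haveI : FiniteDimensional ℚ ↥(IntermediateField.adjoin ℚ ({β} : Set (AlgebraicClosure ℚ))) := IntermediateField.adjoin.finiteDimensional ((AlgebraicClosure.isAlgebraic ℚ).isAlgebraic β).isIntegral
  haveI : NumberField ↥(IntermediateField.adjoin ℚ ({β} : Set (AlgebraicClosure ℚ))) := NumberField.mk
  MonicCubic.exists_ringHom_of_root CubicDisc4827.irreducible_polyQ (aeval_theta_n4827 hβ) (finrank_cubicField_n4827 hβ)
    CubicDisc4827.isUnit_of_disc_eq_sq_mul (((-1) : ℤ) : ZMod 2) (by decide)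

/-- A ring homomorphism `ρ : 𝓞_{ℚ(β)} → ℤ/16` with `ρ(θ) = 5` (`f(5) = 128 ≡ 0 (mod 16)`: `θ` is `2`-adically close to the root at `𝔭₁`, and `𝓞/𝔭₁⁴ ≅ ℤ/16`).
[cite: Marcus2018, Ch. 3, Thm. 27] -/
theorem exists_residueHom_sixteen_n4827 {β : AlgebraicClosure ℚ} (hβ : aeval β ((⟨1, 1, 0, -24, -57⟩ : WeierstrassCurve ℤ).baseChange ℚ).twoTorsionPolynomial.toPoly = 0) :
    ∃ ρ : 𝓞 ↥(IntermediateField.adjoin ℚ ({β} : Set (AlgebraicClosure ℚ))) →+* ZMod 16, ρ (MonicCubic.thetaInt (aeval_theta_n4827 hβ)) = 5 :=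
  haveI : FiniteDimensional ℚ ↥(IntermediateField.adjoin ℚ ({β} : Set (AlgebraicClosure ℚ))) := IntermediateField.adjoin.finiteDimensional ((AlgebraicClosure.isAlgebraic ℚ).isAlgebraic β).isIntegral
  haveI : NumberField ↥(IntermediateField.adjoin ℚ ({β} : Set (AlgebraicClosure ℚ))) := NumberField.mk
  MonicCubic.exists_ringHom_of_root CubicDisc4827.irreducible_polyQ (aeval_theta_n4827 hβ) (finrank_cubicField_n4827 hβ)
    CubicDisc4827.isUnit_of_disc_eq_sq_mul (5 : ZMod 16) (by decide)

/-- **`N((π₁)) = 2`** for `π₁ = −1 − 3θ + 2θ²`: `(π₁) = (2, θ + 1)` (att-p4 g38, `CubicDisc4827.span_2_lin1_eq`) is the kernel of `ψ₂` (Dedekind–Kummer), of index `2`.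
[cite: Marcus2018, Ch. 3, Thm. 27] [cite: LMFDB, number field 3.1.4827.1] -/
theorem absNorm_span_pi1_n4827 {β : AlgebraicClosure ℚ} (hβ : aeval β ((⟨1, 1, 0, -24, -57⟩ : WeierstrassCurve ℤ).baseChange ℚ).twoTorsionPolynomial.toPoly = 0) :
    haveI : FiniteDimensional ℚ ↥(IntermediateField.adjoin ℚ ({β} : Set (AlgebraicClosure ℚ))) := IntermediateField.adjoin.finiteDimensional ((AlgebraicClosure.isAlgebraic ℚ).isAlgebraic β).isIntegral
    haveI : NumberField ↥(IntermediateField.adjoin ℚ ({β} : Set (AlgebraicClosure ℚ))) := NumberField.mk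
    Ideal.absNorm (Ideal.span {(-1 : 𝓞 ↥(IntermediateField.adjoin ℚ ({β} : Set (AlgebraicClosure ℚ)))) + (-3 : 𝓞 ↥(IntermediateField.adjoin ℚ ({β} : Set (AlgebraicClosure ℚ)))) * MonicCubic.thetaInt (aeval_theta_n4827 hβ) + (2 : 𝓞 ↥(IntermediateField.adjoin ℚ ({β} : Set (AlgebraicClosure ℚ)))) * MonicCubic.thetaInt (aeval_theta_n4827 hβ) ^ 2}) = 2 := by
  haveI : FiniteDimensional ℚ ↥(IntermediateField.adjoin ℚ ({β} : Set (AlgebraicClosure ℚ))) := IntermediateField.adjoin.finiteDimensional ((AlgebraicClosure.isAlgebraic ℚ).isAlgebraic β).isIntegral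
  haveI : NumberField ↥(IntermediateField.adjoin ℚ ({β} : Set (AlgebraicClosure ℚ))) := NumberField.mk
  haveI : Fact (Nat.Prime 2) := ⟨Nat.prime_two⟩
  have hθ := aeval_theta_n4827 hβ
  have h3 := finrank_cubicField_n4827 hβ
  obtain ⟨ψ, hψ⟩ := exists_residueHom_two_n4827 hβ
  have hexp : ¬ 2 ∣ RingOfIntegers.exponent (MonicCubic.thetaInt hθ) := by
    rw [MonicCubic.exponent_thetaInt CubicDisc4827.irreducible_polyQ hθ h3 CubicDisc4827.isUnit_of_disc_eq_sq_mul]; decide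
  have hker := MonicCubic.ker_residueHom_eq_span CubicDisc4827.irreducible_polyQ hθ hexp ψ hψ
  have hspan : Ideal.span {((2 : ℕ) : 𝓞 ↥(IntermediateField.adjoin ℚ ({β} : Set (AlgebraicClosure ℚ)))), MonicCubic.thetaInt hθ - (((-1) : ℤ) : 𝓞 ↥(IntermediateField.adjoin ℚ ({β} : Set (AlgebraicClosure ℚ))))} =
      Ideal.span {(-1 : 𝓞 ↥(IntermediateField.adjoin ℚ ({β} : Set (AlgebraicClosure ℚ)))) + (-3 : 𝓞 ↥(IntermediateField.adjoin ℚ ({β} : Set (AlgebraicClosure ℚ)))) * MonicCubic.thetaInt (aeval_theta_n4827 hβ) + (2 : 𝓞 ↥(IntermediateField.adjoin ℚ ({β} : Set (AlgebraicClosure ℚ)))) * MonicCubic.thetaInt (aeval_theta_n4827 hβ) ^ 2} := by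
    rw [Nat.cast_ofNat, show MonicCubic.thetaInt hθ - (((-1) : ℤ) : 𝓞 ↥(IntermediateField.adjoin ℚ ({β} : Set (AlgebraicClosure ℚ)))) = MonicCubic.thetaInt hθ + 1 by push_cast; ring,
      show ((-1 : 𝓞 ↥(IntermediateField.adjoin ℚ ({β} : Set (AlgebraicClosure ℚ)))) + (-3 : 𝓞 ↥(IntermediateField.adjoin ℚ ({β} : Set (AlgebraicClosure ℚ)))) * MonicCubic.thetaInt (aeval_theta_n4827 hβ) + (2 : 𝓞 ↥(IntermediateField.adjoin ℚ ({β} : Set (AlgebraicClosure ℚ)))) * MonicCubic.thetaInt (aeval_theta_n4827 hβ) ^ 2) = -1 - 3 * MonicCubic.thetaInt hθ + 2 * MonicCubic.thetaInt hθ ^ 2 by ring]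
    exact CubicDisc4827.span_2_lin1_eq hθ
  rw [← hspan, ← hker]
  exact absNorm_ker_zmod ψ

/-! ## §2 The row: `rank₂ ≤ 1`, `μ₂ = 0`, `λ₂ ≤ 1` for the cubic field of discriminant `−4827`, modulo `4 ∣ h(ℚ(β,√2))` -/

/-- ★★ **THE PRO-CYCLIC DOOR AT `N = 4827`.**  For `β` ANY root of the `2`-division cubic of `[1,1,0,−24,−57]` and EVERY cyclotomic `ℤ₂`-extension `κ` of the
cubic field `ℚ(β)` (discriminant `−4827 = −3·1609`, `h = 1`, `2 = 𝔭₁𝔭₂`, fundamental unit of `2`-adic depth `3`): **if `2 ≤ ord₂ h(K_1)` then `rank₂ Cl(K_m) ≤ 1` for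
every `m`, `μ₂(κ) = 0` and `λ₂(κ) ≤ 1`.**  Kernel-decided: `N(𝔭₁) = 2`, `ε` a unit (explicit inverse), `ε ∓ 1 ∉ 𝔭₁⁴` (residues `6, 8 (mod 16)` under `θ ↦ 5`).
[cite: Washington1997, §13.3 Prop. 13.22–13.23] [cite: Lang1990, Ch. 13 §4, Lemma 4.1] [cite: Fukuda1994, Thm. 1 (2), p. 264] [cite: LMFDB, number field 3.1.4827.1] -/
theorem classGroupPRank_le_one_cubicField_n4827 {β : AlgebraicClosure ℚ} (hβ : aeval β ((⟨1, 1, 0, -24, -57⟩ : WeierstrassCurve ℤ).baseChange ℚ).twoTorsionPolynomial.toPoly = 0)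
    (κP : ZpExtension ↥(IntermediateField.adjoin ℚ ({β} : Set (AlgebraicClosure ℚ))) 2) (hκP : κP.IsCyclotomic) (he1 : 2 ≤ classNumberPExp κP 1) :
    (∀ m, classGroupPRank κP m ≤ 1) ∧ ClassicalMuVanishes κP ∧ classicalLambda κP ≤ 1 := by
  haveI := isElliptic_n4827
  haveI := isGloballyMinimal_n4827
  haveI : FiniteDimensional ℚ ↥(IntermediateField.adjoin ℚ ({β} : Set (AlgebraicClosure ℚ))) := IntermediateField.adjoin.finiteDimensional ((AlgebraicClosure.isAlgebraic ℚ).isAlgebraic β).isIntegral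
  haveI : NumberField ↥(IntermediateField.adjoin ℚ ({β} : Set (AlgebraicClosure ℚ))) := NumberField.mk
  have hord : IsOrdinaryAt ((⟨1, 1, 0, -24, -57⟩ : WeierstrassCurve ℤ).baseChange ℚ) 2 := goodOrd_two_n4827
  have ht := not_hasRationalTwoTorsionX_n4827
  have h85 := minimalDiscriminantInt_emod_eight_n4827
  have hθ := aeval_theta_n4827 hβ
  have h3 := finrank_cubicField_n4827 hβ
  have hd : ¬ (2 : ℤ) ∣ NumberField.discr ↥(IntermediateField.adjoin ℚ ({β} : Set (AlgebraicClosure ℚ))) := by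
    rw [discr_cubicField_n4827 hβ]; norm_num
  have hh := not_two_dvd_classNumber_cubicField_n4827 hβ
  have hN := absNorm_span_pi1_n4827 hβ
  set θI : 𝓞 ↥(IntermediateField.adjoin ℚ ({β} : Set (AlgebraicClosure ℚ))) := MonicCubic.thetaInt hθ with hθI
  have hrel : θI ^ 3 + (-2 : 𝓞 ↥(IntermediateField.adjoin ℚ ({β} : Set (AlgebraicClosure ℚ)))) * θI ^ 2 + (10 : 𝓞 ↥(IntermediateField.adjoin ℚ ({β} : Set (AlgebraicClosure ℚ)))) * θI + (3 : 𝓞 ↥(IntermediateField.adjoin ℚ ({β} : Set (AlgebraicClosure ℚ)))) = 0 := by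
    have h := MonicCubic.thetaInt_rel hθ
    push_cast at h
    linear_combination h
  -- the unit `ε` and its inverse
  have hεinv : ((-348583873 : 𝓞 ↥(IntermediateField.adjoin ℚ ({β} : Set (AlgebraicClosure ℚ)))) + (74735402 : 𝓞 ↥(IntermediateField.adjoin ℚ ({β} : Set (AlgebraicClosure ℚ)))) * θI + (-32751818 : 𝓞 ↥(IntermediateField.adjoin ℚ ({β} : Set (AlgebraicClosure ℚ)))) * θI ^ 2) * ((1631 : 𝓞 ↥(IntermediateField.adjoin ℚ ({β} : Set (AlgebraicClosure ℚ)))) + (5770 : 𝓞 ↥(IntermediateField.adjoin ℚ ({β} : Set (AlgebraicClosure ℚ)))) * θI + (-58 : 𝓞 ↥(IntermediateField.adjoin ℚ ({β} : Set (AlgebraicClosure ℚ)))) * θI ^ 2) = 1 := by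
    linear_combination ((-189513432288 : 𝓞 ↥(IntermediateField.adjoin ℚ ({β} : Set (AlgebraicClosure ℚ)))) + (1899605444 : 𝓞 ↥(IntermediateField.adjoin ℚ ({β} : Set (AlgebraicClosure ℚ)))) * θI) * hrel
  set ε : (𝓞 ↥(IntermediateField.adjoin ℚ ({β} : Set (AlgebraicClosure ℚ))))ˣ := Units.mkOfMulEqOne _ _ hεinv with hεdef
  have hεval : (ε : 𝓞 ↥(IntermediateField.adjoin ℚ ({β} : Set (AlgebraicClosure ℚ)))) = (-348583873 : 𝓞 ↥(IntermediateField.adjoin ℚ ({β} : Set (AlgebraicClosure ℚ)))) + (74735402 : 𝓞 ↥(IntermediateField.adjoin ℚ ({β} : Set (AlgebraicClosure ℚ)))) * θI + (-32751818 : 𝓞 ↥(IntermediateField.adjoin ℚ ({β} : Set (AlgebraicClosure ℚ)))) * θI ^ 2 := by rw [hεdef, Units.val_mkOfMulEqOne]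
  -- the residue map `ρ : θ ↦ 0 (mod 16)` kills `π₁⁴` but not `ε ∓ 1`
  obtain ⟨ρ, hρ⟩ := exists_residueHom_sixteen_n4827 hβ
  have hρ' : ρ θI = 5 := hρ
  have hρπ : ρ (((-1 : 𝓞 ↥(IntermediateField.adjoin ℚ ({β} : Set (AlgebraicClosure ℚ)))) + (-3 : 𝓞 ↥(IntermediateField.adjoin ℚ ({β} : Set (AlgebraicClosure ℚ)))) * θI + (2 : 𝓞 ↥(IntermediateField.adjoin ℚ ({β} : Set (AlgebraicClosure ℚ)))) * θI ^ 2) ^ 4) = 0 := by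
    rw [map_pow, map_add, map_add, map_mul, map_mul, map_pow, hρ']
    simp only [map_neg, map_ofNat, map_one]
    decide
  have hε1 : (ε : 𝓞 ↥(IntermediateField.adjoin ℚ ({β} : Set (AlgebraicClosure ℚ)))) - 1 ∉ Ideal.span {(-1 : 𝓞 ↥(IntermediateField.adjoin ℚ ({β} : Set (AlgebraicClosure ℚ)))) + (-3 : 𝓞 ↥(IntermediateField.adjoin ℚ ({β} : Set (AlgebraicClosure ℚ)))) * θI + (2 : 𝓞 ↥(IntermediateField.adjoin ℚ ({β} : Set (AlgebraicClosure ℚ)))) * θI ^ 2} ^ 4 := by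
    rw [Ideal.span_singleton_pow, Ideal.mem_span_singleton]
    rintro ⟨γ, hγ⟩
    have h := congrArg ρ hγ
    rw [map_mul, hρπ, zero_mul, hεval, map_sub, map_add, map_add, map_mul, map_mul, map_pow, hρ', map_one] at h
    simp only [map_neg, map_ofNat] at h
    revert h; decide
  have hε2 : (ε : 𝓞 ↥(IntermediateField.adjoin ℚ ({β} : Set (AlgebraicClosure ℚ)))) + 1 ∉ Ideal.span {(-1 : 𝓞 ↥(IntermediateField.adjoin ℚ ({β} : Set (AlgebraicClosure ℚ)))) + (-3 : 𝓞 ↥(IntermediateField.adjoin ℚ ({β} : Set (AlgebraicClosure ℚ)))) * θI + (2 : 𝓞 ↥(IntermediateField.adjoin ℚ ({β} : Set (AlgebraicClosure ℚ)))) * θI ^ 2} ^ 4 := by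
    rw [Ideal.span_singleton_pow, Ideal.mem_span_singleton]
    rintro ⟨γ, hγ⟩
    have h := congrArg ρ hγ
    rw [map_mul, hρπ, zero_mul, hεval, map_add, map_add, map_add, map_mul, map_mul, map_pow, hρ', map_one] at h
    simp only [map_neg, map_ofNat] at h
    revert h; decide
  exact AlignedTransportAtTwoCubicProCyclicDoor.classGroupPRank_le_one_adjoin_of_two_le_of_not_mem_pow_four ((⟨1, 1, 0, -24, -57⟩ : WeierstrassCurve ℤ).baseChange ℚ) hord ht h85 hβ hh hd
    (Ideal.span {(-1 : 𝓞 ↥(IntermediateField.adjoin ℚ ({β} : Set (AlgebraicClosure ℚ)))) + (-3 : 𝓞 ↥(IntermediateField.adjoin ℚ ({β} : Set (AlgebraicClosure ℚ)))) * θI + (2 : 𝓞 ↥(IntermediateField.adjoin ℚ ({β} : Set (AlgebraicClosure ℚ)))) * θI ^ 2}) hN ε hε1 hε2 κP hκP he1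

/-- ★★ **`μ₂ = 0` for every cyclotomic `ℤ₂`-extension of the cubic field of discriminant `−4827` with `4 ∣ h(K_1)`.** [cite: Washington1997, §13.3 Prop. 13.23]
[cite: LMFDB, number field 3.1.4827.1] -/
theorem classicalMuVanishes_cubicField_n4827 {β : AlgebraicClosure ℚ} (hβ : aeval β ((⟨1, 1, 0, -24, -57⟩ : WeierstrassCurve ℤ).baseChange ℚ).twoTorsionPolynomial.toPoly = 0)
    (κP : ZpExtension ↥(IntermediateField.adjoin ℚ ({β} : Set (AlgebraicClosure ℚ))) 2) (hκP : κP.IsCyclotomic) (he1 : 2 ≤ classNumberPExp κP 1) : ClassicalMuVanishes κP :=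
  (classGroupPRank_le_one_cubicField_n4827 hβ κP hκP he1).2.1

end Summit.BirchSwinnertonDyer.BirchSwinnertonDyer.Theorems.AlignedTransportAtTwoCubicProCyclicRowN4827

end
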